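import Summits.ABC.StewartYu.PadicG3OneSizesA
import Summits.ABC.StewartYu.PadicG3RecordR3
import Summits.ABC.StewartYu.PadicG3ClosedLogs
import HarnessLib

/-!
# Cell abc-stewartyu, crux `Y07Odd` (stmt-ABC-19658), `m ≥ 1` branch: the SIZES of p2's closed forms at the record schedule
# `P.sched1b b` in the unit `Z = G·X·L` (PART A, file 2b)

`Summits/ABC/StewartYu/PadicG3OneSizes.lean` — cell `abc-stewartyu` (seat p1-g8; route-holder split 2026-08-27T05:41:03Z).
Theorems only, no named fact.  With `Z := G·X·L` of the v1 family `PadicG3Par` (`PadicG3ParB/D`):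
(record arithmetic in `P`-letters: `PadicG3OneSizesA`.)
* p2's closed forms at `Sc := P.sched1b b` (`b ≥ 1`, heights `h(αⱼ) ≤ Aⱼ`, `Aⱼ ≥ 1`, `log max(3,|bⱼ|) ≤ W`):
  `log max(1, XbC(Lb side lev)) ≤ W + log 2L + 2 log n ≤ (23/20)·H`, `2W + log max(1, XbC) ≤ (63/20)·H` (the comparisons that let the
  shared multi-order budget `τ.1 + |τ.2| ≤ T` be charged at the `τ.1`-rate), `2·log monDen(α, boxExpG (Lb side lev) x) ≤ 2^ν·Z/2` for
  `|x| ≤ NS lev (ν+1)`, `≤ Z/4` at the START point `x = NS 0 0`, the half-point height `2|s₁|·Σ Lbⱼ h(αⱼ) ≤ Z/2` for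
  `|s₁| ≤ 2·NhS (lev+1) − 1`, `log heightProd(α) ≤ Σ Aⱼ ≤ n·Amax`, and the `Y₀`-lines of `M0C` at the k-step / half-step / START points.

WHAT THIS IS NOT: the gains, conditioning and `E`-lines (file `PadicG3OneGain`), or the family lines (file `PadicG3OneLines`).

References: Yu. V. Nesterenko, LNM 1819 (2003) §3.2, §4.2 (4.24)–(4.35), §4.3; K. Yu, Acta Math. 211 (2013) §3.1.
-/

noncomputable section

open Finset Real
open Literature.NumberTheory.Transcendental

namespace Summit.ABC.StewartYu

namespace G3Setup

variable {p : ℕ} [Fact p.Prime] (S : G3Setup p) (P : PadicG3Par S.n) (b : ℝ)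

/-! ### p2's closed forms at `P.sched1b b`, in `Z` -/

/-- `n·X·L ≤ Z/8` (`G ≥ 8(n+1)`). [folklore] -/
theorem n_X_L_le_Z (S : G3Setup p) (P : PadicG3Par S.n) : (S.n : ℝ) * ((P.X : ℝ) * P.L) ≤ P.G * P.X * P.L / 8 := by
  have hG := P.cG_mul_le_G
  unfold PadicG3Par.cG at hG
  have hXL : (0 : ℝ) ≤ (P.X : ℝ) * P.L := by positivity
  rw [le_div_iff₀ (by norm_num)]
  nlinarith [mul_le_mul_of_nonneg_right hG hXL]


/-- **The directional bound**: `log max(1, XbC(Lb side lev)) ≤ W + log(2L) + 2·log n` (`XbC ≤ 2n e^W Σ Lbⱼ ≤ 2n² e^W L`).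
[cite: Nesterenko2003, (4.23); shape only] -/
theorem log_XbC_1b_le (hWb : ∀ j, Real.log (max 3 (|S.b j| : ℝ)) ≤ P.W) (hA1 : ∀ j, 1 ≤ P.A j) (hb : 1 ≤ b) (lev : ℕ) :
    Real.log (max 1 (S.XbC (S.Lb (S.sideS₂ (P.sched1b b)) lev) : ℝ)) ≤ P.W + Real.log (2 * P.L) + 2 * Real.log S.n := by
  have h1 := S.XbC_le hWb (S.Lb (S.sideS₂ (P.sched1b b)) lev)
  have h2 := S.sum_Lb_1b_le' P b hb hA1 lev
  have hn1 : (1 : ℝ) ≤ S.n := by exact_mod_cast P.hn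
  have hL1 : (1 : ℝ) ≤ P.L := P.one_le_L
  have hW : (1 : ℝ) ≤ Real.exp P.W := by have := Real.add_one_le_exp P.W; linarith [P.hW]
  have hbig : (1 : ℝ) ≤ 2 * S.n * Real.exp P.W * (S.n * P.L) := by
    have : (1 : ℝ) ≤ S.n * P.L := by nlinarith
    have : (1 : ℝ) ≤ 2 * S.n * Real.exp P.W := by nlinarith
    nlinarith
  have h3 : (S.XbC (S.Lb (S.sideS₂ (P.sched1b b)) lev) : ℝ) ≤ 2 * S.n * Real.exp P.W * (S.n * P.L) := by
    refine h1.trans ?_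
    exact mul_le_mul_of_nonneg_left h2 (by positivity)
  have h4 : (max 1 (S.XbC (S.Lb (S.sideS₂ (P.sched1b b)) lev) : ℝ) : ℝ) ≤ 2 * S.n * Real.exp P.W * (S.n * P.L) :=
    max_le hbig h3
  have h5 : Real.log (max 1 (S.XbC (S.Lb (S.sideS₂ (P.sched1b b)) lev) : ℝ)) ≤
      Real.log (2 * S.n * Real.exp P.W * (S.n * P.L)) := by
    exact Real.log_le_log (lt_of_lt_of_le zero_lt_one (le_max_left _ _)) h4
  have e : Real.log (2 * S.n * Real.exp P.W * (S.n * P.L)) = P.W + Real.log (2 * P.L) + 2 * Real.log S.n := by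
    have hn0 : (0 : ℝ) < S.n := by linarith
    have hL0 : (0 : ℝ) < P.L := by linarith
    rw [show (2 : ℝ) * S.n * Real.exp P.W * (S.n * P.L) = (2 * P.L) * (S.n * S.n) * Real.exp P.W by ring,
      Real.log_mul (by positivity) (Real.exp_pos _).ne', Real.log_mul (by positivity) (by positivity),
      Real.log_exp, Real.log_mul hn0.ne' hn0.ne']
    ring
  linarith

/-- **`log max(1, XbC(Lb side lev)) ≤ (23/20)·H`** (`W + log 2L + 1 ≤ W_L ≤ H + 1`, `2 log n ≤ (3/20)H`). [folklore] -/
theorem log_XbC_1b_le_H (hWb : ∀ j, Real.log (max 3 (|S.b j| : ℝ)) ≤ P.W) (hA1 : ∀ j, 1 ≤ P.A j) (hb : 1 ≤ b) (lev : ℕ) :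
    Real.log (max 1 (S.XbC (S.Lb (S.sideS₂ (P.sched1b b)) lev) : ℝ)) ≤ (23 / 20) * P.H := by
  have h1 := S.log_XbC_1b_le P b hWb hA1 hb lev
  have h2 := P.W_add_log_le_WL
  have h3 := P.WL_le_H_add_one
  have h4 := P.two_log_n_le_H
  linarith

/-- **`2W + log max(1, XbC(Lb side lev)) ≤ (63/20)·H`** (the half-step's `|τ.2|`-rate is below its `τ.1`-rate `(69/20)H`). [folklore] -/
theorem two_W_add_log_XbC_1b_le_H (hWb : ∀ j, Real.log (max 3 (|S.b j| : ℝ)) ≤ P.W) (hA1 : ∀ j, 1 ≤ P.A j) (hb : 1 ≤ b)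
    (lev : ℕ) :
    2 * P.W + Real.log (max 1 (S.XbC (S.Lb (S.sideS₂ (P.sched1b b)) lev) : ℝ)) ≤ (63 / 20) * P.H := by
  have h1 := S.log_XbC_1b_le_H P b hWb hA1 hb lev
  have h2 := P.W_add_log_le_WL
  have h3 := P.WL_le_H_add_one
  have hlog : 0 ≤ Real.log (2 * (P.L : ℝ)) := Real.log_nonneg (by linarith [P.one_le_L])
  linarith

/-- **The k-step far height**: `2·log monDen(α, boxExpG (Lb side lev) x) ≤ 2^ν·Z/2` for `|x| ≤ NS lev (ν+1)` (`h(αⱼ) ≤ Aⱼ`).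
[cite: Nesterenko2003, §4.2 (4.35); shape only] -/
theorem two_log_monDen_box_1b_le (hV : ∀ j, Height.logHeight₁ (S.α j) ≤ P.A j) (hb : 1 ≤ b) (lev ν : ℕ) {x : ℤ}
    (hx : |x| ≤ (S.NS (P.sched1b b) lev (ν + 1) : ℤ)) :
    2 * Real.log (MonomialDen.monDen S.α (S.boxExpG (S.Lb (S.sideS₂ (P.sched1b b)) lev) x) : ℝ) ≤
      2 ^ ν * (P.G * P.X * P.L / 2) := by
  have h1 := S.log_monDen_boxExpG_le (S.Lb (S.sideS₂ (P.sched1b b)) lev) x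
  have h2 : ∑ j, (S.Lb (S.sideS₂ (P.sched1b b)) lev j : ℝ) * Height.logHeight₁ (S.α j) ≤ S.n * P.L / 2 ^ lev := by
    refine le_trans (sum_le_sum fun j _ => ?_) (S.sum_Lb_mul_A_1b_le P b hb lev)
    exact mul_le_mul_of_nonneg_left (hV j) (by positivity)
  have hx' : |(x : ℝ)| ≤ 2 ^ (ν + 1) * (2 ^ lev * P.X / 2) := by
    have h3 : |(x : ℝ)| ≤ ((S.NS (P.sched1b b) lev (ν + 1) : ℕ) : ℝ) := by exact_mod_cast hx
    exact h3.trans (S.NS_1b_real_le P b lev (ν + 1))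
  have hXL := P.X_mul_L_le_Z
  have hn1 : (1 : ℝ) ≤ S.n := by exact_mod_cast P.hn
  have hx0 : (0 : ℝ) ≤ |(x : ℝ)| := abs_nonneg _
  have hs0 : (0 : ℝ) ≤ ∑ j, (S.Lb (S.sideS₂ (P.sched1b b)) lev j : ℝ) * Height.logHeight₁ (S.α j) :=
    sum_nonneg fun j _ => mul_nonneg (by positivity) (Height.zero_le_logHeight₁ _)
  have h4 : 2 * |(x : ℝ)| * ∑ j, (S.Lb (S.sideS₂ (P.sched1b b)) lev j : ℝ) * Height.logHeight₁ (S.α j) ≤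
      2 * (2 ^ (ν + 1) * (2 ^ lev * P.X / 2)) * (S.n * P.L / 2 ^ lev) :=
    mul_le_mul (mul_le_mul_of_nonneg_left hx' (by norm_num)) h2 hs0 (by positivity)
  have e : 2 * (2 ^ (ν + 1) * (2 ^ lev * (P.X : ℝ) / 2)) * (S.n * P.L / 2 ^ lev) = 2 ^ ν * (2 * S.n * (P.X * P.L)) := by
    field_simp; ring
  rw [e] at h4
  have h5 : 2 * (S.n : ℝ) * (P.X * P.L) ≤ P.G * P.X * P.L / 4 := by
    have := S.n_X_L_le_Z P; linarith
  have h2ν : (0 : ℝ) ≤ 2 ^ ν := by positivity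
  calc 2 * Real.log (MonomialDen.monDen S.α (S.boxExpG (S.Lb (S.sideS₂ (P.sched1b b)) lev) x) : ℝ)
      ≤ 2 * (2 * |(x : ℝ)| * ∑ j, (S.Lb (S.sideS₂ (P.sched1b b)) lev j : ℝ) * Height.logHeight₁ (S.α j)) := by linarith
    _ ≤ 2 * (2 ^ ν * (2 * S.n * (P.X * P.L))) := by linarith
    _ = 2 ^ ν * (2 * (2 * S.n * (P.X * P.L))) := by ring
    _ ≤ 2 ^ ν * (2 * (P.G * P.X * P.L / 4)) := mul_le_mul_of_nonneg_left (by linarith) h2ν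
    _ = 2 ^ ν * (P.G * P.X * P.L / 2) := by ring

/-- **The START far height**: `2·log monDen(α, boxExpG (Lb side 0) X₀) ≤ Z/4` at `X₀ = NS 0 0 = Xs 0 ≤ X/2`. [folklore] -/
theorem two_log_monDen_start_1b_le (hV : ∀ j, Height.logHeight₁ (S.α j) ≤ P.A j) (hb : 1 ≤ b) :
    2 * Real.log (MonomialDen.monDen S.α (S.boxExpG (S.Lb (S.sideS₂ (P.sched1b b)) 0) (S.NS (P.sched1b b) 0 0 : ℤ)) : ℝ) ≤
      P.G * P.X * P.L / 4 := by
  have h1 := S.log_monDen_boxExpG_le (S.Lb (S.sideS₂ (P.sched1b b)) 0) (S.NS (P.sched1b b) 0 0 : ℤ)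
  have h2 : ∑ j, (S.Lb (S.sideS₂ (P.sched1b b)) 0 j : ℝ) * Height.logHeight₁ (S.α j) ≤ S.n * P.L / 2 ^ 0 := by
    refine le_trans (sum_le_sum fun j _ => ?_) (S.sum_Lb_mul_A_1b_le P b hb 0)
    exact mul_le_mul_of_nonneg_left (hV j) (by positivity)
  rw [pow_zero, div_one] at h2
  have hx' : |(((S.NS (P.sched1b b) 0 0 : ℕ) : ℤ) : ℝ)| ≤ P.X / 2 := by
    have h := S.NS_1b_real_le P b 0 0
    simp only [pow_zero, one_mul] at h
    have e : (((S.NS (P.sched1b b) 0 0 : ℕ) : ℤ) : ℝ) = ((S.NS (P.sched1b b) 0 0 : ℕ) : ℝ) := Int.cast_natCast _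
    rw [e, abs_of_nonneg (by positivity)]; exact h
  have hXL := P.X_mul_L_le_Z
  have hx0 : (0 : ℝ) ≤ |(((S.NS (P.sched1b b) 0 0 : ℕ) : ℤ) : ℝ)| := abs_nonneg _
  have hs0 : (0 : ℝ) ≤ ∑ j, (S.Lb (S.sideS₂ (P.sched1b b)) 0 j : ℝ) * Height.logHeight₁ (S.α j) :=
    sum_nonneg fun j _ => mul_nonneg (by positivity) (Height.zero_le_logHeight₁ _)
  have h4 : 2 * |(((S.NS (P.sched1b b) 0 0 : ℕ) : ℤ) : ℝ)| * ∑ j, (S.Lb (S.sideS₂ (P.sched1b b)) 0 j : ℝ) * Height.logHeight₁ (S.α j) ≤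
      2 * (P.X / 2) * (S.n * P.L) :=
    mul_le_mul (mul_le_mul_of_nonneg_left hx' (by norm_num)) h2 hs0 (by positivity)
  have h5 : (S.n : ℝ) * (P.X * P.L) ≤ P.G * P.X * P.L / 8 := S.n_X_L_le_Z P
  nlinarith

/-- **The half-point height**: `2|s₁|·Σⱼ Lb(lev)ⱼ h(αⱼ) ≤ Z/2` for odd `|s₁| ≤ 2·NhS (lev+1) − 1` (so `2·(this) ≤ Z`, the (S1) charge).
[cite: Nesterenko2003, §4.3 (4.45); shape only] -/
theorem halfHeight_1b_le (hV : ∀ j, Height.logHeight₁ (S.α j) ≤ P.A j) (hb : 1 ≤ b) (lev : ℕ) {s₁ : ℤ}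
    (hs : |s₁| ≤ (2 * S.NhS (P.sched1b b) (lev + 1) - 1 : ℤ)) :
    2 * |(s₁ : ℝ)| * ∑ j, (S.Lb (S.sideS₂ (P.sched1b b)) lev j : ℝ) * Height.logHeight₁ (S.α j) ≤ P.G * P.X * P.L / 2 := by
  have h2 : ∑ j, (S.Lb (S.sideS₂ (P.sched1b b)) lev j : ℝ) * Height.logHeight₁ (S.α j) ≤ S.n * P.L / 2 ^ lev := by
    refine le_trans (sum_le_sum fun j _ => ?_) (S.sum_Lb_mul_A_1b_le P b hb lev)
    exact mul_le_mul_of_nonneg_left (hV j) (by positivity)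
  have hs' : |(s₁ : ℝ)| ≤ 2 * (2 ^ (lev + 1) * P.X / 2) := by
    have h3 : |(s₁ : ℝ)| ≤ 2 * ((S.NhS (P.sched1b b) (lev + 1) : ℕ) : ℝ) - 1 := by exact_mod_cast hs
    have h4 := S.NhS_1b_real_le P b (lev + 1)
    linarith
  have hXL := P.X_mul_L_le_Z
  have hs0 : (0 : ℝ) ≤ ∑ j, (S.Lb (S.sideS₂ (P.sched1b b)) lev j : ℝ) * Height.logHeight₁ (S.α j) :=
    sum_nonneg fun j _ => mul_nonneg (by positivity) (Height.zero_le_logHeight₁ _)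
  have h4 : 2 * |(s₁ : ℝ)| * ∑ j, (S.Lb (S.sideS₂ (P.sched1b b)) lev j : ℝ) * Height.logHeight₁ (S.α j) ≤
      2 * (2 * (2 ^ (lev + 1) * P.X / 2)) * (S.n * P.L / 2 ^ lev) :=
    mul_le_mul (mul_le_mul_of_nonneg_left hs' (by norm_num)) h2 hs0 (by positivity)
  have e : 2 * (2 * (2 ^ (lev + 1) * (P.X : ℝ) / 2)) * (S.n * P.L / 2 ^ lev) = 4 * S.n * (P.X * P.L) := by
    field_simp; ring
  rw [e] at h4
  have h5 : 4 * (S.n : ℝ) * (P.X * P.L) ≤ P.G * P.X * P.L / 2 := by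
    have := S.n_X_L_le_Z P; linarith
  linarith

/-- **`log heightProd(α) ≤ Σⱼ Aⱼ`** (`log max(|num|, den) = h(αⱼ) ≤ Aⱼ`). [folklore] -/
theorem log_heightProd_le (hV : ∀ j, Height.logHeight₁ (S.α j) ≤ P.A j) :
    Real.log (CW77.heightProd S.α) ≤ ∑ j, P.A j := by
  unfold CW77.heightProd
  rw [Real.log_prod]
  · refine sum_le_sum fun j _ => ?_
    rw [show Real.log (CW77.hgt (S.α j)) = Height.logHeight₁ (S.α j) by
      rw [Rat.logHeight₁_eq_log_max]; rfl]
    exact hV j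
  · intro j _
    exact (lt_of_lt_of_le zero_lt_one (CW77.one_le_hgt _)).ne'

/-- `3·log heightProd(α) ≤ Z/32`. [folklore] -/
theorem three_log_heightProd_le_Z (hV : ∀ j, Height.logHeight₁ (S.α j) ≤ P.A j) :
    3 * Real.log (CW77.heightProd S.α) ≤ P.G * P.X * P.L / 32 := by
  have h1 := S.log_heightProd_le P hV
  have h2 := P.sum_A_le
  have h3 := P.n_mul_Amax_le_Z
  have hZ := P.GXL_ge
  linarith

/-! ### The `Y₀`-lines of `M0C` at the three kinds of points -/

/-- k-step points: `L₀·(1 + log(1 + |2^{Ŝ−lev}x|/H)) ≤ Z/4 + yload` for `|x| ≤ NS lev (ν+1)`, `ν + 1 ≤ n`, `lev ≤ Ŝ`. [folklore] -/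
theorem L0_line_K_1b_le {lev ν : ℕ} (hlev : lev ≤ P.Sdepth) (hν : ν + 1 ≤ S.n) {x : ℤ}
    (hx : |x| ≤ (S.NS (P.sched1b b) lev (ν + 1) : ℤ)) :
    (P.L₀ : ℝ) * (1 + Real.log (1 + |((2 ^ (P.Sdepth - lev) * x : ℤ) : ℝ)| / P.H)) ≤ P.G * P.X * P.L / 4 + P.yload := by
  have hH1 : (1 : ℝ) ≤ P.H := by exact_mod_cast P.one_le_H
  have hH0 : (0 : ℝ) < P.H := by linarith
  refine P.L0_line_le (by positivity) ?_
  have hx' : |(x : ℝ)| ≤ 2 ^ (ν + 1) * (2 ^ lev * P.X / 2) := by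
    have h3 : |(x : ℝ)| ≤ ((S.NS (P.sched1b b) lev (ν + 1) : ℕ) : ℝ) := by exact_mod_cast hx
    exact h3.trans (S.NS_1b_real_le P b lev (ν + 1))
  have hX9 := P.X_le_nine_H
  have e1 : |((2 ^ (P.Sdepth - lev) * x : ℤ) : ℝ)| = 2 ^ (P.Sdepth - lev) * |(x : ℝ)| := by
    push_cast; rw [abs_mul, abs_of_nonneg (by positivity)]
  rw [e1, div_le_iff₀ hH0]
  have h2 : (2 : ℝ) ^ (P.Sdepth - lev) * (2 ^ (ν + 1) * (2 ^ lev * P.X / 2)) = 2 ^ (P.Sdepth + ν) * P.X := by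
    have : (2 : ℝ) ^ (P.Sdepth - lev) * 2 ^ lev = 2 ^ P.Sdepth := by rw [← pow_add, Nat.sub_add_cancel hlev]
    calc (2 : ℝ) ^ (P.Sdepth - lev) * (2 ^ (ν + 1) * (2 ^ lev * P.X / 2))
        = (2 ^ (P.Sdepth - lev) * 2 ^ lev) * 2 ^ ν * P.X := by rw [pow_succ]; ring
      _ = 2 ^ (P.Sdepth + ν) * P.X := by rw [this, pow_add]
  have h3 : (2 : ℝ) ^ (P.Sdepth + ν) ≤ 2 ^ (P.Sdepth + S.n) := pow_le_pow_right₀ (by norm_num) (by omega)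
  have hX0 : (0 : ℝ) ≤ P.X := by positivity
  calc (2 : ℝ) ^ (P.Sdepth - lev) * |(x : ℝ)| ≤ 2 ^ (P.Sdepth - lev) * (2 ^ (ν + 1) * (2 ^ lev * P.X / 2)) :=
        mul_le_mul_of_nonneg_left hx' (by positivity)
    _ = 2 ^ (P.Sdepth + ν) * P.X := h2
    _ ≤ 2 ^ (P.Sdepth + S.n) * (9 * P.H) := mul_le_mul h3 hX9 hX0 (by positivity)
    _ = 9 * 2 ^ (P.Sdepth + S.n) * P.H := by ring

/-- half points: `L₀·(1 + log(1 + |2^{Ŝ−(lev+1)}s₁|/H)) ≤ Z/4 + yload` for `|s₁| ≤ 2·NhS (lev+1) − 1`, `lev + 1 ≤ Ŝ`. [folklore] -/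
theorem L0_line_H_1b_le {lev : ℕ} (hlev : lev + 1 ≤ P.Sdepth) {s₁ : ℤ}
    (hs : |s₁| ≤ (2 * S.NhS (P.sched1b b) (lev + 1) - 1 : ℤ)) :
    (P.L₀ : ℝ) * (1 + Real.log (1 + |((2 ^ (P.Sdepth - (lev + 1)) * s₁ : ℤ) : ℝ)| / P.H)) ≤ P.G * P.X * P.L / 4 + P.yload := by
  have hH1 : (1 : ℝ) ≤ P.H := by exact_mod_cast P.one_le_H
  have hH0 : (0 : ℝ) < P.H := by linarith
  refine P.L0_line_le (by positivity) ?_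
  have hs' : |(s₁ : ℝ)| ≤ 2 * (2 ^ (lev + 1) * P.X / 2) := by
    have h3 : |(s₁ : ℝ)| ≤ 2 * ((S.NhS (P.sched1b b) (lev + 1) : ℕ) : ℝ) - 1 := by exact_mod_cast hs
    have h4 := S.NhS_1b_real_le P b (lev + 1)
    linarith
  have hX9 := P.X_le_nine_H
  have e1 : |((2 ^ (P.Sdepth - (lev + 1)) * s₁ : ℤ) : ℝ)| = 2 ^ (P.Sdepth - (lev + 1)) * |(s₁ : ℝ)| := by
    push_cast; rw [abs_mul, abs_of_nonneg (by positivity)]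
  rw [e1, div_le_iff₀ hH0]
  have h2 : (2 : ℝ) ^ (P.Sdepth - (lev + 1)) * (2 * (2 ^ (lev + 1) * P.X / 2)) = 2 ^ P.Sdepth * P.X := by
    have : (2 : ℝ) ^ (P.Sdepth - (lev + 1)) * 2 ^ (lev + 1) = 2 ^ P.Sdepth := by rw [← pow_add, Nat.sub_add_cancel hlev]
    calc (2 : ℝ) ^ (P.Sdepth - (lev + 1)) * (2 * (2 ^ (lev + 1) * P.X / 2))
        = (2 ^ (P.Sdepth - (lev + 1)) * 2 ^ (lev + 1)) * P.X := by ring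
      _ = 2 ^ P.Sdepth * P.X := by rw [this]
  have h3 : (2 : ℝ) ^ P.Sdepth ≤ 2 ^ (P.Sdepth + S.n) := pow_le_pow_right₀ (by norm_num) (by omega)
  have hX0 : (0 : ℝ) ≤ P.X := by positivity
  calc (2 : ℝ) ^ (P.Sdepth - (lev + 1)) * |(s₁ : ℝ)| ≤ 2 ^ (P.Sdepth - (lev + 1)) * (2 * (2 ^ (lev + 1) * P.X / 2)) :=
        mul_le_mul_of_nonneg_left hs' (by positivity)
    _ = 2 ^ P.Sdepth * P.X := h2
    _ ≤ 2 ^ (P.Sdepth + S.n) * (9 * P.H) := mul_le_mul h3 hX9 hX0 (by positivity)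
    _ = 9 * 2 ^ (P.Sdepth + S.n) * P.H := by ring

/-- START point: `L₀·(1 + log(1 + |2^{Ŝ−0}X₀|/H)) ≤ Z/4 + yload` at `X₀ = NS 0 0`. [folklore] -/
theorem L0_line_start_1b_le :
    (P.L₀ : ℝ) * (1 + Real.log (1 + |((2 ^ (P.Sdepth - 0) * (S.NS (P.sched1b b) 0 0 : ℤ) : ℤ) : ℝ)| / P.H)) ≤
      P.G * P.X * P.L / 4 + P.yload := by
  have hH1 : (1 : ℝ) ≤ P.H := by exact_mod_cast P.one_le_H
  have hH0 : (0 : ℝ) < P.H := by linarith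
  refine P.L0_line_le (by positivity) ?_
  have hx' : (((S.NS (P.sched1b b) 0 0 : ℕ) : ℤ) : ℝ) ≤ P.X / 2 := by
    have h := S.NS_1b_real_le P b 0 0
    simp only [pow_zero, one_mul] at h
    have e : (((S.NS (P.sched1b b) 0 0 : ℕ) : ℤ) : ℝ) = ((S.NS (P.sched1b b) 0 0 : ℕ) : ℝ) := Int.cast_natCast _
    rw [e]; exact h
  have hX9 := P.X_le_nine_H
  have e1 : |((2 ^ (P.Sdepth - 0) * (S.NS (P.sched1b b) 0 0 : ℤ) : ℤ) : ℝ)| = 2 ^ P.Sdepth * (((S.NS (P.sched1b b) 0 0 : ℕ) : ℤ) : ℝ) := by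
    rw [Nat.sub_zero]; push_cast; rw [abs_of_nonneg (by positivity)]
  rw [e1, div_le_iff₀ hH0]
  have h3 : (2 : ℝ) ^ P.Sdepth ≤ 2 ^ (P.Sdepth + S.n) := pow_le_pow_right₀ (by norm_num) (by omega)
  have hX0 : (0 : ℝ) ≤ P.X / 2 := by positivity
  calc (2 : ℝ) ^ P.Sdepth * (((S.NS (P.sched1b b) 0 0 : ℕ) : ℤ) : ℝ) ≤ 2 ^ P.Sdepth * (P.X / 2) :=
        mul_le_mul_of_nonneg_left hx' (by positivity)
    _ ≤ 2 ^ (P.Sdepth + S.n) * (9 * P.H) := mul_le_mul h3 (by linarith) hX0 (by positivity)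
    _ = 9 * 2 ^ (P.Sdepth + S.n) * P.H := by ring

end G3Setup

end Summit.ABC.StewartYu

end
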